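import Mathlib.Algebra.BigOperators.Ring.Finset
import Mathlib.Algebra.Order.BigOperators.Group.Finset
import Mathlib.Data.Matrix.Mul
import Mathlib.Tactic.Ring
import Mathlib.Tactic.Positivity
import Summits.CriticalPhenomena.PercolationContinuityZ3.Theorems.PercNearOneGluingNoHeavyLowerTailAntiBandBlockSum

/-!
# `NoHeavyLowerTail` (crux stmt-CriticalPhenomena-4575), lane prim-ineq-gen-4 (gen 28): generic lemmas for TYPE-FREE FRAME CERTIFICATES

Support file (`--supports stmt-CriticalPhenomena-4575`; memo `run/shared/lean/prim/prim-ineq-gen-4/FINDING-*-g28.md`).  No definitions, no `sorry`, standard axioms.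

A universal frame (FINDING-FRAMES-g22) is `w x y = [x ⊆ y] · b(#x, #y)` on the ball `{x : #x ≤ k}`; its Gram entries
`G(x,x') = Σ_{y ⊇ x} Σ_{y' ⊇ x'} b(#x,#y) b(#x',#y') C(n−1−#(y∪y'), k)` depend only on `(#x, #x', #(x∩x'))`.  This file supplies the three
generic finite-sum identities used by the per-cell certificate files `…AntiBandFrame_<n>_<k>*.lean`:
* `sum_supersets_card_le` — the sum over the supersets `y ⊇ x` with `#y ≤ k` of a weight depending on `(#y, #(y ∩ b))` as an explicit double sum
  over `(q, r) = (#((y∖x) ∩ b), #((y∖x) ∖ b))` with multiplicities `C(#(b∖x), q)·C(#((x∪b)ᶜ), r)` (two-block count of `AntiBandBlockCount`);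
* `frame_qform_expand` — `W(a)·M·W(a) = Σ_{x,x'} a_x a_{x'} G(x,x')` for frame vectors `W(a)(y) = Σ_x a_x w(x,y)`;
* `sum_sum_mul_delta_add_gramsum` — `Σ_{x,x'} a_x a_{x'} (ε[x=x'] + Σ_w Σ_m c_m g_m(x,w) g_m(x',w)) = ε Σ_x a_x² + Σ_w Σ_m c_m (Σ_x g_m(x,w) a_x)²`.
-/

namespace Summit.CriticalPhenomena.PercolationContinuityZ3.Theorems.AntiBandFrameSOS

open Finset Matrix

variable {β : Type*} [DecidableEq β]

/-- `a ⊆ b ↔ #(a ∩ b) = #a`. [elementary] -/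
theorem subset_iff_card_inter_eq (a b : Finset β) : a ⊆ b ↔ #(a ∩ b) = #a := by
  constructor
  · intro h; rw [inter_eq_left.mpr h]
  · intro h
    have : a ∩ b = a := Finset.eq_of_subset_of_card_le inter_subset_left (by rw [h])
    rw [← this]; exact inter_subset_right

/-- The filtered four-fold profile sum of `sum_powersetCard_card_inter_eq_sum_blocks` as a nested sum over `(p₁, p₂, p₃)` with `p₄ = j − p₁ − p₂ − p₃`. [elementary] -/
theorem sum_filter_four_eq_nested {R : Type*} [AddCommMonoid R] (j : ℕ) (f : (ℕ × ℕ) × (ℕ × ℕ) → R) :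
    ∑ p ∈ ((range (j + 1) ×ˢ range (j + 1)) ×ˢ (range (j + 1) ×ˢ range (j + 1))).filter
        (fun p => p.1.1 + p.1.2 + p.2.1 + p.2.2 = j), f p
      = ∑ p₁ ∈ range (j + 1), ∑ p₂ ∈ range (j + 1), ∑ p₃ ∈ range (j + 1 - p₁ - p₂),
          f ((p₁, p₂), (p₃, j - p₁ - p₂ - p₃)) := by
  rw [Finset.sum_filter]
  simp only [Finset.sum_product]
  apply Finset.sum_congr rfl; intro p₁ _
  apply Finset.sum_congr rfl; intro p₂ _
  have hset : (range (j + 1)).filter (fun p₃ => p₁ + p₂ + p₃ ≤ j) = range (j + 1 - p₁ - p₂) := by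
    ext x; simp only [mem_filter, mem_range]; omega
  rw [← hset, Finset.sum_filter]
  apply Finset.sum_congr rfl; intro p₃ _
  by_cases h : p₁ + p₂ + p₃ ≤ j
  · rw [if_pos h, Finset.sum_eq_single (j - p₁ - p₂ - p₃)]
    · rw [if_pos (by omega)]
    · intro p₄ _ hne; rw [if_neg (by omega)]
    · intro hnot; exfalso; rw [mem_range] at hnot; omega
  · rw [if_neg h]; apply Finset.sum_eq_zero; intro p₄ _; rw [if_neg (by omega)]

/-- Two-set block sum in nested form: `Σ_{#w=j} F(#(w∩a), #(w∩b)) = Σ_{p₁,p₂,p₃} C(#(a∩b),p₁) C(#(a\b),p₂) C(#(b\a),p₃) C(#(a∪b)ᶜ, j−p₁−p₂−p₃) · F(p₁+p₂, p₁+p₃)`.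
[gen 27 `AntiBandBlockCount.sum_powersetCard_card_inter_eq_sum_blocks` + `sum_filter_four_eq_nested`] -/
theorem sum_powersetCard_card_inter_eq_nested {R : Type*} [CommSemiring R] [Fintype β] (a b : Finset β) (j : ℕ) (F : ℕ → ℕ → R) :
    ∑ w ∈ (univ : Finset β).powersetCard j, F #(w ∩ a) #(w ∩ b)
      = ∑ p₁ ∈ range (j + 1), ∑ p₂ ∈ range (j + 1), ∑ p₃ ∈ range (j + 1 - p₁ - p₂),
          (((#(a ∩ b)).choose p₁ * (#(a \ b)).choose p₂ * (#(b \ a)).choose p₃ * (#((a ∪ b)ᶜ)).choose (j - p₁ - p₂ - p₃) : ℕ) : R)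
            * F (p₁ + p₂) (p₁ + p₃) := by
  rw [AntiBandBlockCount.sum_powersetCard_card_inter_eq_sum_blocks a b j F, sum_filter_four_eq_nested]

/-- **Frame Gram on the subtype ball, as iterated superset sums.**  For the frame `w x y = [x ⊆ y] B(#x,#y)` on `{x : Finset (Fin n) // #x < l}`, `l = k+1`,
and `M(y,y') = C(n−1−#(y∪y'), k)`:  `Σ_{y,y'} w(x,y) M(y,y') w(x',y') = Σ_{y ⊇ x, #y ≤ k} B(#x,#y) Σ_{y' ⊇ x', #y' ≤ k} B(#x',#y') C(n−1−(#y+#y'−#(y'∩y)), k)`. [gen 28] -/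
theorem frame_gram_subtype (n l k : ℕ) (hl : l = k + 1) (B : ℕ → ℕ → ℚ) (x x' : {x : Finset (Fin n) // #x < l}) :
    ∑ y : {x : Finset (Fin n) // #x < l}, ∑ y' : {x : Finset (Fin n) // #x < l},
        (fun (x y : {x : Finset (Fin n) // #x < l}) =>
            if (x : Finset (Fin n)) ⊆ (y : Finset (Fin n)) then B #(x : Finset (Fin n)) #(y : Finset (Fin n)) else (0 : ℚ)) x y
          * (Matrix.of fun (x x' : {x : Finset (Fin n) // #x < l}) => ((n - 1 - #((x : Finset (Fin n)) ∪ x')).choose k : ℚ)) y y'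
          * (fun (x y : {x : Finset (Fin n) // #x < l}) =>
            if (x : Finset (Fin n)) ⊆ (y : Finset (Fin n)) then B #(x : Finset (Fin n)) #(y : Finset (Fin n)) else (0 : ℚ)) x' y'
      = ∑ y ∈ (univ : Finset (Fin n)).powerset.filter (fun y => (x : Finset (Fin n)) ⊆ y ∧ #y ≤ k),
          B #(x : Finset (Fin n)) #y
            * ∑ y' ∈ (univ : Finset (Fin n)).powerset.filter (fun y' => (x' : Finset (Fin n)) ⊆ y' ∧ #y' ≤ k),
                B #(x' : Finset (Fin n)) #y' * (((n - 1 - (#y + #y' - #(y' ∩ y))).choose k : ℕ) : ℚ) := by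
  subst hl
  set T : Finset (Finset (Fin n)) := (univ : Finset (Fin n)).powerset.filter (fun y => #y < k + 1) with hT
  have hmem : ∀ y : Finset (Fin n), y ∈ T ↔ #y < k + 1 := by
    intro y; rw [hT, mem_filter, mem_powerset]; exact ⟨fun h => h.2, fun h => ⟨subset_univ _, h⟩⟩
  simp only [Matrix.of_apply]
  -- subtype sums to sums over `T`
  have hconv : ∀ g : Finset (Fin n) → ℚ, ∑ y : {x : Finset (Fin n) // #x < k + 1}, g y = ∑ y ∈ T, g y :=
    fun g => (Finset.sum_subtype T hmem g).symm
  rw [hconv (fun y => ∑ y' : {x : Finset (Fin n) // #x < k + 1},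
      (if (x : Finset (Fin n)) ⊆ y then B #(x : Finset (Fin n)) #y else 0)
        * ((n - 1 - #(y ∪ (y' : Finset (Fin n)))).choose k : ℚ)
        * (if (x' : Finset (Fin n)) ⊆ (y' : Finset (Fin n)) then B #(x' : Finset (Fin n)) #(y' : Finset (Fin n)) else 0))]
  have hinner : ∀ y : Finset (Fin n),
      ∑ y' : {x : Finset (Fin n) // #x < k + 1},
        (if (x : Finset (Fin n)) ⊆ y then B #(x : Finset (Fin n)) #y else 0)
          * ((n - 1 - #(y ∪ (y' : Finset (Fin n)))).choose k : ℚ)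
          * (if (x' : Finset (Fin n)) ⊆ (y' : Finset (Fin n)) then B #(x' : Finset (Fin n)) #(y' : Finset (Fin n)) else 0)
      = ∑ y' ∈ T, (if (x : Finset (Fin n)) ⊆ y then B #(x : Finset (Fin n)) #y else 0)
          * ((n - 1 - #(y ∪ y')).choose k : ℚ)
          * (if (x' : Finset (Fin n)) ⊆ y' then B #(x' : Finset (Fin n)) #y' else 0) := by
    intro y
    exact hconv (fun y' => (if (x : Finset (Fin n)) ⊆ y then B #(x : Finset (Fin n)) #y else 0)
          * ((n - 1 - #(y ∪ y')).choose k : ℚ)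
          * (if (x' : Finset (Fin n)) ⊆ y' then B #(x' : Finset (Fin n)) #y' else 0))
  simp only [hinner]
  -- pull the indicator of `x ⊆ y` out, restrict the ranges
  have hfilt : ∀ z : Finset (Fin n), T.filter (fun y => z ⊆ y) = (univ : Finset (Fin n)).powerset.filter (fun y => z ⊆ y ∧ #y ≤ k) := by
    intro z; ext y; simp only [hT, mem_filter, mem_powerset]; constructor
    · rintro ⟨⟨hu, hc⟩, hz⟩; exact ⟨hu, hz, by omega⟩
    · rintro ⟨hu, hz, hc⟩; exact ⟨⟨hu, by omega⟩, hz⟩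
  have hout : ∀ y ∈ T, ∑ y' ∈ T, (if (x : Finset (Fin n)) ⊆ y then B #(x : Finset (Fin n)) #y else 0)
          * ((n - 1 - #(y ∪ y')).choose k : ℚ)
          * (if (x' : Finset (Fin n)) ⊆ y' then B #(x' : Finset (Fin n)) #y' else 0)
      = if (x : Finset (Fin n)) ⊆ y then B #(x : Finset (Fin n)) #y
          * ∑ y' ∈ (univ : Finset (Fin n)).powerset.filter (fun y' => (x' : Finset (Fin n)) ⊆ y' ∧ #y' ≤ k),
              B #(x' : Finset (Fin n)) #y' * (((n - 1 - (#y + #y' - #(y' ∩ y))).choose k : ℕ) : ℚ) else 0 := by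
    intro y _
    by_cases hxy : (x : Finset (Fin n)) ⊆ y
    · simp only [if_pos hxy]
      conv_rhs => rw [← hfilt, Finset.sum_filter, Finset.mul_sum]
      apply Finset.sum_congr rfl; intro y' _
      by_cases hxy' : (x' : Finset (Fin n)) ⊆ y'
      · rw [if_pos hxy', if_pos hxy']
        have hu : #(y ∪ y') = #y + #y' - #(y' ∩ y) := by
          have := Finset.card_union_add_card_inter y y'; rw [inter_comm] at this; omega
        rw [hu]; ring
      · rw [if_neg hxy', if_neg hxy']; ring
    · simp only [if_neg hxy, zero_mul, Finset.sum_const_zero]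
  rw [Finset.sum_congr rfl hout, ← Finset.sum_filter, hfilt]

/-- **Superset sum.**  For finsets `x, b` of a fintype, `k : ℕ` and a weight `F : ℕ → ℕ → R`:
`Σ_{y ⊇ x, #y ≤ k} F(#y, #(y∩b)) = Σ_{q,r ≤ k} [#x+q+r ≤ k] · C(#(b∖x), q) · C(#((x∪b)ᶜ), r) · F(#x+q+r, #(x∩b)+q)`
(`y = x ⊔ c`, `q = #(c ∩ b)`, `r = #(c ∖ b)`). [gen 28; two-block count `AntiBandBlockCount.card_filter_powerset_two_blocks`] -/
theorem sum_supersets_card_le [Fintype β] {R : Type*} [CommSemiring R] (x b : Finset β) (k : ℕ) (F : ℕ → ℕ → R) :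
    ∑ y ∈ (univ : Finset β).powerset.filter (fun y => x ⊆ y ∧ #y ≤ k), F #y #(y ∩ b)
      = ∑ q ∈ range (k + 1), ∑ r ∈ range (k + 1),
          if #x + q + r ≤ k then (((#(b \ x)).choose q * (#((x ∪ b)ᶜ)).choose r : ℕ) : R) * F (#x + q + r) (#(x ∩ b) + q)
          else 0 := by
  classical
  set P₁ := b \ x with hP1
  set P₂ := (x ∪ b)ᶜ with hP2
  have h12 : Disjoint P₁ P₂ := by
    rw [hP1, hP2]; exact disjoint_compl_right_iff.mpr (sdiff_subset.trans subset_union_right)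
  have hunion : P₁ ∪ P₂ = xᶜ := by
    ext e; simp only [hP1, hP2, mem_union, mem_sdiff, mem_compl]; tauto
  -- Step 1: reindex the supersets `y` of `x` by `c = y \ x ⊆ xᶜ`
  have step1 : ∑ y ∈ (univ : Finset β).powerset.filter (fun y => x ⊆ y ∧ #y ≤ k), F #y #(y ∩ b)
      = ∑ c ∈ (xᶜ).powerset.filter (fun c => #x + #c ≤ k), F (#x + #(c ∩ P₁) + #(c ∩ P₂)) (#(x ∩ b) + #(c ∩ P₁)) := by
    symm
    apply Finset.sum_bij (fun c _ => x ∪ c)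
    · intro c hc
      rw [mem_filter, mem_powerset] at hc
      have hdisj : Disjoint x c := disjoint_left.mpr (fun e hex hec => (mem_compl.mp (hc.1 hec)) hex)
      rw [mem_filter, mem_powerset, card_union_of_disjoint hdisj]
      exact ⟨subset_univ _, subset_union_left, hc.2⟩
    · intro c₁ hc₁ c₂ hc₂ heq
      rw [mem_filter, mem_powerset] at hc₁ hc₂
      have h1 : c₁ = (x ∪ c₁) \ x := by
        ext e; simp only [mem_sdiff, mem_union]
        constructor
        · intro he; exact ⟨Or.inr he, fun hex => (mem_compl.mp (hc₁.1 he)) hex⟩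
        · rintro ⟨h | h, hne⟩
          · exact absurd h hne
          · exact h
      have h2 : c₂ = (x ∪ c₂) \ x := by
        ext e; simp only [mem_sdiff, mem_union]
        constructor
        · intro he; exact ⟨Or.inr he, fun hex => (mem_compl.mp (hc₂.1 he)) hex⟩
        · rintro ⟨h | h, hne⟩
          · exact absurd h hne
          · exact h
      rw [h1, h2, heq]
    · intro y hy
      rw [mem_filter, mem_powerset] at hy
      refine ⟨y \ x, ?_, ?_⟩
      · rw [mem_filter, mem_powerset]
        refine ⟨fun e he => mem_compl.mpr (mem_sdiff.mp he).2, ?_⟩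
        have : #x + #(y \ x) = #y := by
          rw [card_sdiff_of_subset hy.2.1]; have := card_le_card hy.2.1; omega
        omega
      · exact union_sdiff_of_subset hy.2.1
    · intro c hc
      rw [mem_filter, mem_powerset] at hc
      have hdisj : Disjoint x c := disjoint_left.mpr (fun e hex hec => (mem_compl.mp (hc.1 hec)) hex)
      have hcsplit : #(c ∩ P₁) + #(c ∩ P₂) = #c := by
        have hc12 : c ∩ P₁ ∪ c ∩ P₂ = c := by
          rw [← inter_union_distrib_left, hunion]; exact inter_eq_left.mpr hc.1
        have hd : Disjoint (c ∩ P₁) (c ∩ P₂) :=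
          disjoint_left.mpr (fun e h1 h2 => (disjoint_left.mp h12) (mem_inter.mp h1).2 (mem_inter.mp h2).2)
        rw [← card_union_of_disjoint hd, hc12]
      have hcard : #(x ∪ c) = #x + #(c ∩ P₁) + #(c ∩ P₂) := by
        rw [card_union_of_disjoint hdisj]; omega
      have hinter : #((x ∪ c) ∩ b) = #(x ∩ b) + #(c ∩ P₁) := by
        have hsplit : (x ∪ c) ∩ b = x ∩ b ∪ c ∩ P₁ := by
          ext e; simp only [hP1, mem_inter, mem_union, mem_sdiff]
          constructor
          · rintro ⟨h | h, hb⟩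
            · exact Or.inl ⟨h, hb⟩
            · exact Or.inr ⟨h, hb, fun hex => (mem_compl.mp (hc.1 h)) hex⟩
          · rintro (⟨h, hb⟩ | ⟨h, hb, _⟩)
            · exact ⟨Or.inl h, hb⟩
            · exact ⟨Or.inr h, hb⟩
        have hd : Disjoint (x ∩ b) (c ∩ P₁) :=
          disjoint_left.mpr (fun e h1 h2 => (disjoint_left.mp hdisj) (mem_inter.mp h1).1 (mem_inter.mp h2).1)
        rw [hsplit, card_union_of_disjoint hd]
      rw [hcard, hinter]
  rw [step1]
  -- Step 2: fibrewise over the profile `(q, r) = (#(c ∩ P₁), #(c ∩ P₂))`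
  set S := (xᶜ).powerset.filter (fun c => #x + #c ≤ k) with hSdef
  set T := (range (k + 1) ×ˢ range (k + 1)) with hTdef
  set prof : Finset β → ℕ × ℕ := fun c => (#(c ∩ P₁), #(c ∩ P₂)) with hprof
  have hcsplit : ∀ c ∈ (xᶜ).powerset, #(c ∩ P₁) + #(c ∩ P₂) = #c := by
    intro c hc
    rw [mem_powerset] at hc
    have hc12 : c ∩ P₁ ∪ c ∩ P₂ = c := by
      rw [← inter_union_distrib_left, hunion]; exact inter_eq_left.mpr hc
    have hd : Disjoint (c ∩ P₁) (c ∩ P₂) :=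
      disjoint_left.mpr (fun e h1 h2 => (disjoint_left.mp h12) (mem_inter.mp h1).2 (mem_inter.mp h2).2)
    rw [← card_union_of_disjoint hd, hc12]
  have hmaps : ∀ c ∈ S, prof c ∈ T := by
    intro c hc
    rw [hSdef, mem_filter] at hc
    have := hcsplit c hc.1
    rw [hTdef, mem_product, mem_range, mem_range]
    simp only [hprof]
    constructor <;> omega
  rw [← Finset.sum_fiberwise_of_maps_to hmaps, hTdef, Finset.sum_product]
  apply Finset.sum_congr rfl; intro q _
  apply Finset.sum_congr rfl; intro r _
  have hfib_val : ∀ c ∈ S.filter (fun c => prof c = (q, r)),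
      F (#x + #(c ∩ P₁) + #(c ∩ P₂)) (#(x ∩ b) + #(c ∩ P₁)) = F (#x + q + r) (#(x ∩ b) + q) := by
    intro c hc
    rw [mem_filter] at hc
    obtain ⟨_, hpc⟩ := hc
    simp only [hprof, Prod.mk.injEq] at hpc
    rw [hpc.1, hpc.2]
  rw [Finset.sum_congr rfl hfib_val, Finset.sum_const, nsmul_eq_mul]
  by_cases hle : #x + q + r ≤ k
  · rw [if_pos hle]
    congr 1
    have hfib : S.filter (fun c => prof c = (q, r))
        = (P₁ ∪ P₂).powerset.filter (fun c => #(c ∩ P₁) = q ∧ #(c ∩ P₂) = r) := by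
      ext c
      simp only [hSdef, mem_filter, mem_powerset, hunion, hprof, Prod.mk.injEq]
      constructor
      · rintro ⟨⟨hc, _⟩, h1, h2⟩; exact ⟨hc, h1, h2⟩
      · rintro ⟨hc, h1, h2⟩
        refine ⟨⟨hc, ?_⟩, h1, h2⟩
        have := hcsplit c (mem_powerset.mpr hc)
        omega
    rw [hfib, AntiBandBlockCount.card_filter_powerset_two_blocks P₁ P₂ h12 q r]
  · rw [if_neg hle]
    have hempty : S.filter (fun c => prof c = (q, r)) = ∅ := by
      rw [Finset.filter_eq_empty_iff]
      intro c hc hpc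
      simp only [hSdef, mem_filter] at hc
      simp only [hprof, Prod.mk.injEq] at hpc
      have := hcsplit c hc.1
      omega
    rw [hempty, card_empty, Nat.cast_zero, zero_mul]

/-- Rearrangement: `Σ_a Σ_b x_a x_b Σ_w Σ_m c_m G_m(a,w) G_m(b,w) = Σ_w Σ_m c_m (Σ_a G_m(a,w) x_a)²`. [elementary] -/
theorem sum_sum_mul_gramsum_eq_sum_sq {α γ : Type*} (s : Finset α) (t : Finset γ) (r : Finset ℕ) (x : α → ℚ) (c : ℕ → ℚ)
    (G : ℕ → α → γ → ℚ) :
    ∑ a ∈ s, ∑ b ∈ s, x a * x b * ∑ w ∈ t, ∑ m ∈ r, c m * (G m a w * G m b w)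
      = ∑ w ∈ t, ∑ m ∈ r, c m * (∑ a ∈ s, G m a w * x a) ^ 2 := by
  have h1 : ∀ w ∈ t, ∀ m ∈ r, c m * (∑ a ∈ s, G m a w * x a) ^ 2 = ∑ a ∈ s, ∑ b ∈ s, x a * x b * (c m * (G m a w * G m b w)) := by
    intro w _ m _
    rw [sq, Finset.sum_mul_sum, Finset.mul_sum]
    apply Finset.sum_congr rfl; intro a _
    rw [Finset.mul_sum]
    apply Finset.sum_congr rfl; intro b _
    ring
  calc ∑ a ∈ s, ∑ b ∈ s, x a * x b * ∑ w ∈ t, ∑ m ∈ r, c m * (G m a w * G m b w)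
      = ∑ a ∈ s, ∑ b ∈ s, ∑ w ∈ t, ∑ m ∈ r, x a * x b * (c m * (G m a w * G m b w)) := by
        apply Finset.sum_congr rfl; intro a _
        apply Finset.sum_congr rfl; intro b _
        rw [Finset.mul_sum]
        apply Finset.sum_congr rfl; intro w _
        rw [Finset.mul_sum]
    _ = ∑ a ∈ s, ∑ w ∈ t, ∑ b ∈ s, ∑ m ∈ r, x a * x b * (c m * (G m a w * G m b w)) := by
        apply Finset.sum_congr rfl; intro a _
        exact Finset.sum_comm
    _ = ∑ w ∈ t, ∑ a ∈ s, ∑ b ∈ s, ∑ m ∈ r, x a * x b * (c m * (G m a w * G m b w)) := Finset.sum_comm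
    _ = ∑ w ∈ t, ∑ a ∈ s, ∑ m ∈ r, ∑ b ∈ s, x a * x b * (c m * (G m a w * G m b w)) := by
        apply Finset.sum_congr rfl; intro w _
        apply Finset.sum_congr rfl; intro a _
        exact Finset.sum_comm
    _ = ∑ w ∈ t, ∑ m ∈ r, ∑ a ∈ s, ∑ b ∈ s, x a * x b * (c m * (G m a w * G m b w)) := by
        apply Finset.sum_congr rfl; intro w _
        exact Finset.sum_comm
    _ = ∑ w ∈ t, ∑ m ∈ r, c m * (∑ a ∈ s, G m a w * x a) ^ 2 := by
        apply Finset.sum_congr rfl; intro w hw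
        apply Finset.sum_congr rfl; intro m hm
        rw [h1 w hw m hm]

/-- `v ⬝ (M v) = Σ_y Σ_{y'} v_y M_{y y'} v_{y'}`. [elementary] -/
theorem dotProduct_mulVec_eq_sum_sum {S : Type*} [Fintype S] {R : Type*} [CommRing R] (M : Matrix S S R) (v : S → R) :
    v ⬝ᵥ (M *ᵥ v) = ∑ y, ∑ y', v y * M y y' * v y' := by
  simp only [dotProduct, Matrix.mulVec, Finset.mul_sum]
  apply Finset.sum_congr rfl; intro y _
  apply Finset.sum_congr rfl; intro y' _
  ring

/-- **Frame quadratic form.**  For frame vectors `W(a)(y) = Σ_x a_x w(x,y)`: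
`W(a) ⬝ (M W(a)) = Σ_x Σ_{x'} a_x a_{x'} Σ_y Σ_{y'} w(x,y) M(y,y') w(x',y')`. [elementary] -/
theorem frame_qform_expand {S : Type*} [Fintype S] {R : Type*} [CommRing R] (w : S → S → R) (M : Matrix S S R) (a : S → R) :
    (fun y => ∑ x, a x * w x y) ⬝ᵥ (M *ᵥ fun y => ∑ x, a x * w x y)
      = ∑ x, ∑ x', a x * a x' * ∑ y, ∑ y', w x y * M y y' * w x' y' := by
  rw [dotProduct_mulVec_eq_sum_sum]
  have hL : ∑ y, ∑ y', (∑ x, a x * w x y) * M y y' * (∑ x, a x * w x y')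
      = ∑ y, ∑ y', ∑ x, ∑ x', a x * a x' * (w x y * M y y' * w x' y') := by
    apply Finset.sum_congr rfl; intro y _
    apply Finset.sum_congr rfl; intro y' _
    rw [Finset.sum_mul, Finset.sum_mul_sum]
    apply Finset.sum_congr rfl; intro x _
    apply Finset.sum_congr rfl; intro x' _
    ring
  have hR : ∑ x, ∑ x', a x * a x' * ∑ y, ∑ y', w x y * M y y' * w x' y'
      = ∑ x, ∑ x', ∑ y, ∑ y', a x * a x' * (w x y * M y y' * w x' y') := by
    apply Finset.sum_congr rfl; intro x _
    apply Finset.sum_congr rfl; intro x' _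
    rw [Finset.mul_sum]
    apply Finset.sum_congr rfl; intro y _
    rw [Finset.mul_sum]
  rw [hL, hR]
  calc ∑ y, ∑ y', ∑ x, ∑ x', a x * a x' * (w x y * M y y' * w x' y')
      = ∑ y, ∑ x, ∑ y', ∑ x', a x * a x' * (w x y * M y y' * w x' y') := by
        apply Finset.sum_congr rfl; intro y _
        exact Finset.sum_comm
    _ = ∑ x, ∑ y, ∑ y', ∑ x', a x * a x' * (w x y * M y y' * w x' y') := Finset.sum_comm
    _ = ∑ x, ∑ y, ∑ x', ∑ y', a x * a x' * (w x y * M y y' * w x' y') := by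
        apply Finset.sum_congr rfl; intro x _
        apply Finset.sum_congr rfl; intro y _
        exact Finset.sum_comm
    _ = ∑ x, ∑ x', ∑ y, ∑ y', a x * a x' * (w x y * M y y' * w x' y') := by
        apply Finset.sum_congr rfl; intro x _
        exact Finset.sum_comm

/-- **SOS with slack.**  `Σ_x Σ_{x'} a_x a_{x'} (ε[x = x'] + Σ_w Σ_m c_m g_m(x,w) g_m(x',w)) = ε Σ_x a_x² + Σ_w Σ_m c_m (Σ_x g_m(x,w) a_x)²`. [elementary] -/
theorem sum_sum_mul_delta_add_gramsum {α γ : Type*} [DecidableEq α] (s : Finset α) (t : Finset γ) (r : Finset ℕ) (x : α → ℚ)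
    (ε : ℚ) (c : ℕ → ℚ) (G : ℕ → α → γ → ℚ) :
    ∑ a ∈ s, ∑ b ∈ s, x a * x b * ((if a = b then ε else 0) + ∑ w ∈ t, ∑ m ∈ r, c m * (G m a w * G m b w))
      = ε * ∑ a ∈ s, x a ^ 2 + ∑ w ∈ t, ∑ m ∈ r, c m * (∑ a ∈ s, G m a w * x a) ^ 2 := by
  have hsplit : ∀ a ∈ s, ∀ b ∈ s,
      x a * x b * ((if a = b then ε else 0) + ∑ w ∈ t, ∑ m ∈ r, c m * (G m a w * G m b w))
        = (if a = b then ε * (x a * x b) else 0) + x a * x b * ∑ w ∈ t, ∑ m ∈ r, c m * (G m a w * G m b w) := by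
    intro a _ b _
    split_ifs <;> ring
  rw [Finset.sum_congr rfl (fun a ha => Finset.sum_congr rfl (fun b hb => hsplit a ha b hb))]
  simp only [Finset.sum_add_distrib]
  rw [sum_sum_mul_gramsum_eq_sum_sq]
  congr 1
  rw [Finset.mul_sum]
  apply Finset.sum_congr rfl; intro a ha
  rw [Finset.sum_ite_eq s a (fun b => ε * (x a * x b))]  -- ∑ b ∈ s, if a = b then f b else 0 = if a ∈ s then f a else 0
  rw [if_pos ha]; ring

/-- `Σ_a Σ_b x_a x_b (−G(a,b)) = −Σ_a Σ_b x_a x_b G(a,b)`. [elementary] -/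
theorem sum_sum_mul_neg {α : Type*} (s : Finset α) (x : α → ℚ) (G : α → α → ℚ) :
    ∑ a ∈ s, ∑ b ∈ s, x a * x b * (-G a b) = -(∑ a ∈ s, ∑ b ∈ s, x a * x b * G a b) := by
  rw [← Finset.sum_neg_distrib]
  apply Finset.sum_congr rfl; intro a _
  rw [← Finset.sum_neg_distrib]
  apply Finset.sum_congr rfl; intro b _
  rw [mul_neg]

end Summit.CriticalPhenomena.PercolationContinuityZ3.Theorems.AntiBandFrameSOS
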